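import Mathlib
import Literature.Analysis.FluidPDE.BoundedL2ClassicalMild
import Literature.Analysis.FluidPDE.AncientMildCurlCompactness
import Literature.Analysis.FluidPDE.KNSSLimitOseenIdentity
import Literature.Analysis.FluidPDE.CurlFreeLiouville
import Literature.Analysis.FluidPDE.NSBoundedMildOseenClassical
import Literature.Analysis.FluidPDE.NSCriticalClosureBesovBounded
import Literature.Analysis.FluidPDE.TaoLocalisationHolds
import HarnessLib

/-!
# `VorticityPace.TypeIImpliesPace` (item stmt-NavierStokesRegularity-7782) — tools:
# a KNSS zoom whose vorticities die out converges to a uniform stream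

Helper file for the support item `Theses.VorticityPace.TypeIImpliesPace`, proved in
`VorticityPaceTypeIImpliesPace.lean`. Two tools.

* `TypeIImpliesPace.exists_const_of_zoom_curl_vanishing` — let `(V_j, P_j)` be classical solutions
  of unforced Navier–Stokes (`ν = 1`) on `(A_j, B_j) × ℝ³`, `A_j → −∞`, `0 < B_j`, bounded by `2` on
  `(A_j, 0]` with a uniform `L²` bound on the slices there, converging pointwise on `(−∞, 0) × ℝ³`
  to `v`, and assume the vorticities DIE OUT: for every `t < 0`, `y`, `ε > 0`, eventually
  `‖curl V_j(t)(y)‖ ≤ ε`. Then `v` is ONE constant vector on `(−∞, 0) × ℝ³`.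
  PROOF: each `V_j` is Oseen-mild on `(A_j, 0)` (KNSS Lemma 3.1, finite energy kills the parasitic
  drift: `mild_of_bounded_of_eLpNorm_two_le_of_lt`); KNSS Lemma 6.1 with vorticity
  (`exists_ancientMild_limit_curl_tendsto`) gives a subsequence converging with its curls to a
  smooth bounded Oseen-mild ancient field `W`, which is `v` on the open slab (limits are unique) and
  has `curl W ≡ 0`; a bounded smooth field with `curl = 0`, `div = 0` is constant on every slice
  (Liouville, `eq_of_curl_eq_zero_of_isDivFree_of_bounded`), and the Oseen identity forces one
  constant for all slices (KNSS Remark 6.1, `eq_of_oseenIdentity_of_slice_const`).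
* `TypeIImpliesPace.exists_typeI_envelope` — a classical solution on `[0, T)`, Leray–Hopf from a
  rapidly decaying datum, blowing up at the Type-I rate near `T`, obeys a GLOBAL envelope
  `‖u(t, x)‖ √(T − t) ≤ C₁` on `[0, T)` (sub-slab boundedness from Tao's class,
  `exists_forall_norm_le_of_tao2011`).

HONEST FRAMING: lemmas about HYPOTHETICAL rescaled blow-up sequences (other route, not a
pub-ns-dss cell file); nothing here bears on the regularity problem itself.

References: Koch–Nadirashvili–Seregin–Šverák 2009, §3 Lemma 3.1, §4, §6 Lemma 6.1 and Remark 6.1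
(arXiv:0709.3599). [KochNadirashviliSereginSverak2009]
-/

noncomputable section

set_option linter.dupNamespace false

namespace Summit.NavierStokesRegularity.NavierStokesRegularity.Theorems

open MeasureTheory Set Function Filter Topology TopologicalSpace Metric
open scoped NNReal ENNReal ContDiff
open Literature.Analysis Literature.Analysis.FluidPDE

namespace TypeIImpliesPace

/-- **A KNSS zoom whose vorticities die out converges to a uniform stream** (module docstring):
classical `(V_j, P_j)` (`ν = 1`) on `(A_j, B_j) × ℝ³`, `A_j → −∞`, `0 < B_j`, `‖V_j‖ ≤ 2` on
`(A_j, 0]` with a uniform `L²` bound there, `V_j → v` pointwise on the open slab, and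
`curl V_j(t)(y) → 0` for every `t < 0`, `y`; then `v(t, y) = b` for one vector `b`, all `t < 0`, `y`.
[cite: KochNadirashviliSereginSverak2009, §6 Lemma 6.1 and Remark 6.1, §3 Lemma 3.1 (arXiv:0709.3599 pp. 7, 11)] -/
theorem exists_const_of_zoom_curl_vanishing {A B : ℕ → ℝ}
    {V : ℕ → ℝ → EuclideanSpace ℝ (Fin 3) → EuclideanSpace ℝ (Fin 3)}
    {P : ℕ → ℝ → EuclideanSpace ℝ (Fin 3) → ℝ}
    {v : ℝ → EuclideanSpace ℝ (Fin 3) → EuclideanSpace ℝ (Fin 3)}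
    (hAtend : Tendsto A atTop atBot) (hBpos : ∀ j, 0 < B j)
    (hVcl : ∀ j, IsClassicalNSSolutionOn (Ioo (A j) (B j)) 1 0 (V j) (P j))
    (hVbd : ∀ j, ∀ s ∈ Ioc (A j) 0, ∀ y, ‖V j s y‖ ≤ 2)
    (hVK : ∀ j, ∃ K : ℝ≥0∞, K ≠ ⊤ ∧ ∀ s ∈ Ioc (A j) 0, eLpNorm (V j s) 2 volume ≤ K)
    (hVlim : ∀ t < 0, ∀ x, Tendsto (fun j => V j t x) atTop (𝓝 (v t x)))
    (hcurl : ∀ t < 0, ∀ y, ∀ ε > (0 : ℝ), ∀ᶠ j in atTop, ‖curl (V j t) y‖ ≤ ε) :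
    ∃ b : EuclideanSpace ℝ (Fin 3), ∀ t < 0, ∀ y, v t y = b := by
  -- continuity, divergence and the Oseen identity of the rescaled solutions on `(A j, 0)`
  have hVcont0 : ∀ j, ContinuousOn (uncurry (V j)) (Ioo (A j) 0 ×ˢ univ) := fun j =>
    (hVcl j).smooth_velocity.continuousOn.mono
      (prod_mono (Ioo_subset_Ioo_right (hBpos j).le) Subset.rfl)
  have hVsm : ∀ j, ∀ s ∈ Ioo (A j) (B j), ContDiff ℝ ∞ (V j s) := fun j s hs =>
    (hVcl j).contDiff_velocity hs
  have hVdiv : ∀ j, ∀ s ∈ Ioo (A j) 0, IsWeaklyDivFree (V j s) := fun j s hs =>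
    VectorCalculus.IsDivFree.isWeaklyDivFree_holds
      ((hVcl j).divFree s ⟨hs.1, hs.2.trans (hBpos j)⟩)
      (contDiff_infty.1 (hVsm j s ⟨hs.1, hs.2.trans (hBpos j)⟩) 1)
  have hVbd' : ∀ j, ∀ s ∈ Ioo (A j) 0, ∀ y, ‖V j s y‖ ≤ 2 := fun j s hs y =>
    hVbd j s ⟨hs.1, hs.2.le⟩ y
  have hVmild : ∀ j, ∀ s t : ℝ, A j < s → s < t → t < 0 → ∀ x,
      V j t x = UnboundedOperators.heatExtension (V j s) (t - s) x -
        oseenDuhamel 1 s (V j) (V j) t x := fun j s t hAs hst ht0 x => by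
    obtain ⟨K, hKtop, hK⟩ := hVK j
    exact mild_of_bounded_of_eLpNorm_two_le_of_lt (hVcl j) (hAs.trans (hst.trans ht0)) (hBpos j)
      (fun r hr y => hVbd j r hr y) hKtop (fun r hr => hK r hr) hAs hst ht0 x
  -- KNSS Lemma 6.1 with vorticity
  obtain ⟨φ, W, hφ, -, hWdiv, hWbd, hWmild, hWsm, -, hWpt, hWcurl⟩ :=
    exists_ancientMild_limit_curl_tendsto (B := 2) hAtend hVcont0 hVdiv hVmild hVbd'
  -- the limit is `v` on the open slab
  have hWv : ∀ t < 0, ∀ x, W t x = v t x := fun t ht x =>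
    tendsto_nhds_unique (hWpt t ht x) ((hVlim t ht x).comp hφ.tendsto_atTop)
  -- its vorticity vanishes
  have hWcurl0 : ∀ t < 0, ∀ y, curl (W t) y = 0 := by
    intro t ht y
    refine norm_le_zero_iff.1 (le_of_forall_pos_le_add fun ε hε => ?_)
    rw [zero_add]
    refine le_of_tendsto ((hWcurl t ht y).norm) ?_
    exact hφ.tendsto_atTop.eventually (hcurl t ht y ε hε)
  -- every slice is constant (Liouville for bounded curl- and divergence-free fields)
  have hslice : ∀ t < 0, ∀ y, W t y = W t 0 := by
    intro t ht y
    have h2 : ContDiff ℝ 2 (W t) := contDiff_infty.1 (hWsm t ht) 2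
    have h1 : ContDiff ℝ 1 (W t) := contDiff_infty.1 (hWsm t ht) 1
    exact eq_of_curl_eq_zero_of_isDivFree_of_bounded h2 (hWcurl0 t ht)
      ((hWdiv t ht).isDivFree_of_contDiff h1) (fun x => hWbd t ht x) y 0
  -- the Oseen identity pins the constants (KNSS Remark 6.1)
  have hconst := eq_of_oseenIdentity_of_slice_const hWmild hslice
  refine ⟨W (-1) 0, fun t ht y => ?_⟩
  rw [← hWv t ht y]
  exact hconst t ht (-1) (by norm_num) y

/-- **Global Type-I envelope.** A classical solution on `[0, T)`, Leray–Hopf from a rapidly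
decaying datum, with the Type-I rate `‖u(t)‖_∞ ≤ C/√(T − t)` near `T`, satisfies
`‖u(t, x)‖ √(T − t) ≤ C₁` for ALL `t ∈ [0, T)` (before the Type-I window, `u` is bounded on the
sub-slab: Tao 2013 Cor. 11.1, `exists_forall_norm_le_of_tao2011`). [cite: Tao2011, Cor. 11.1] -/
theorem exists_typeI_envelope {ν T : ℝ} (hν : 0 < ν) (hT : 0 < T)
    {u : ℝ → EuclideanSpace ℝ (Fin 3) → EuclideanSpace ℝ (Fin 3)}
    {p : ℝ → EuclideanSpace ℝ (Fin 3) → ℝ}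
    (hcl : IsClassicalNSSolutionOn (Ico 0 T) ν 0 u p) (hLH : IsLerayHopfOn T ν 0 (u 0) u)
    (hdec : HasRapidSpatialDecay (u 0)) (hI : IsTypeIBlowup u T) :
    ∃ C₁ : ℝ, 0 ≤ C₁ ∧ ∀ t ∈ Ico 0 T, ∀ x, ‖u t x‖ * Real.sqrt (T - t) ≤ C₁ := by
  obtain ⟨C, hC⟩ := hI
  obtain ⟨tI, htI, hsub⟩ := (mem_nhdsLT_iff_exists_Ioo_subset).1 hC
  -- the sub-slab `[0, a]`, `a = max tI (T/2) ∈ (0, T)`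
  set a : ℝ := max tI (T / 2) with ha
  have haT : a ∈ Ioo 0 T := ⟨lt_max_of_lt_right (by linarith), max_lt htI (by linarith)⟩
  obtain ⟨M, hM⟩ := exists_forall_norm_le_of_tao2011 tao2011_hasBoundedSobolevNormsOn_holds hν
    hcl hLH hdec a haT
  have hM0 : 0 ≤ M := (norm_nonneg _).trans (hM 0 ⟨le_rfl, haT.1.le⟩ 0)
  refine ⟨max C (M * Real.sqrt T), le_max_of_le_right (by positivity), fun t ht x => ?_⟩
  have hTt : 0 < T - t := sub_pos.2 ht.2
  rcases le_or_gt t a with hta | hta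
  · -- before `a`: the sub-slab bound
    have h1 : ‖u t x‖ ≤ M := hM t ⟨ht.1, hta⟩ x
    have h2 : Real.sqrt (T - t) ≤ Real.sqrt T := Real.sqrt_le_sqrt (by linarith [ht.1])
    calc ‖u t x‖ * Real.sqrt (T - t) ≤ M * Real.sqrt T :=
          mul_le_mul h1 h2 (Real.sqrt_nonneg _) hM0
      _ ≤ max C (M * Real.sqrt T) := le_max_right _ _
  · -- inside the Type-I window
    have htmem : t ∈ Ioo tI T := ⟨(le_max_left _ _).trans_lt hta, ht.2⟩
    have h1 : ‖u t x‖ ≤ C / Real.sqrt (T - t) := hsub htmem x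
    have hs : 0 < Real.sqrt (T - t) := Real.sqrt_pos.2 hTt
    calc ‖u t x‖ * Real.sqrt (T - t) ≤ C / Real.sqrt (T - t) * Real.sqrt (T - t) :=
          mul_le_mul_of_nonneg_right h1 hs.le
      _ = C := div_mul_cancel₀ _ hs.ne'
      _ ≤ max C (M * Real.sqrt T) := le_max_left _ _

end TypeIImpliesPace

end Summit.NavierStokesRegularity.NavierStokesRegularity.Theorems

end
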